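import Summits.Ventures.CertifiedManyBodySolver.Observables.KTTransitionCeilingRowK3
import Summits.Ventures.CertifiedManyBodySolver.Observables.StiffnessTLSeqCeiling
import Summits.Ventures.CertifiedManyBodySolver.Observables.RungLeavesStiffnessAnchor
import HarnessLib

/-!
# Ventures/CertifiedManyBodySolver — Observables/KTTransitionCeilingRowK3Seq.lean

HONEST FRAMING: the SEQUENCE-ROBUST reading of a certified `t′ = 0` odd-moment (Krylov-3) stiffness row, and with it the B1′-K3
Kosterlitz–Thouless decimal in EXACTLY the shape of the cell's other `t′ = 0` rows (`KTTransitionCeilingRows.kt_tp0_kinlo_EXT5Lp_le_decimal`):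
hypotheses = the three claim nodes BY NAME + the KT dictionary `KTDictionaryAt 0 8 (7/8) ρe Tc` (K2 stability, K3 monotonicity, K1b
SEQUENCE-ROBUST identification) — no plain-identification hypothesis (cf. `KTTransitionCeilingRowK3.kt_tp0_stiffK3_EXT5Lp_le_decimal`, which
needed it because the node file reads the edge into the plain leaf). Still `U = 8` only: the odd-moment functional has no `U`-ray transport.
Not a `T_c` estimate, not a superconductivity verdict; a MATERIAL ceiling only through the separately stated 2D → 3D transfer (K4).

What is new here is PLUMBING, mirroring for the `t′ = 0` word `oddMomentObs U λ` what `StiffnessTLSeqCeiling.lean` does for the `t–t′` word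
`oddMomentObsTT` (hubbard-obs-p2): `fluxStiffness_le_of_torusLimit_oddMoment_orbit_certificate_seq` (the `D₄`-orbit certificate along a
PRESCRIBED sequence of sides, via the `t–t′` generic adapter `fluxStiffness_le_of_torusLimitTT'_functional_row_seq` at `t′ = 0` and
`hubbardTorusTT'_zero`), `fluxStiffness_le_of_oddMoment_orbitLowerRow_neg_seq` (registry shape: LOWER orbit row on the negated word + energy
cap ⇒ ceiling), the leaf discharger `ObsStiffnessSeqCeilingAt_tp0_of_oddMoment_orbitLowerRow` (`fluxEnergyTT'_tPrime_zero`), the K3 node's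
robust leaf `obs0b_stiffK3_lamm3o256_EXT5Lp_M3U8tp0_c354f473_up_stiffnessSeqLeafAt_of`, and the decimal `kt_tp0_stiffK3_EXT5Lp_le_decimal_seq :
… → Tc ≤ 0.2615160`.

Cell `hubbard-tc` (MO-S3), seat p1 (`prover-hubbard-tc-p1-g2-0`), 2026-08-27 (lead ask 00:37Z, exact-shape follow-up). No definition, no
named fact, zero computation, no `sorry`.

References: D. J. Scalapino, S. R. White, S.-C. Zhang, PRB 47 (1993) 7995, §II [ScalapinoWhiteZhang1993]; E. Lipparini (2008), eq. (8.30)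
[Lipparini2008]; T. Hazra, N. Verma, M. Randeria, PRX 9 (2019) 031049, eqs. (2)–(3) [HazraVermaRanderia2019].
-/

noncomputable section

namespace Summit.Ventures.CertifiedManyBodySolver.Observables

open Matrix Finset Filter Topology Real
open Literature.MathematicalPhysics.QuantumLattice
open Literature.MathematicalPhysics.QuantumLattice.ThermodynamicLimit
open Literature.MathematicalPhysics.QuantumFieldTheory
open Literature.Probability.LatticeModels
open Summit.Ventures.CertifiedManyBodySolver.Certificates
open scoped ComplexOrder ComplexConjugate Topology BigOperators

/-! ### §1 The `t′ = 0` odd-moment orbit certificate along a prescribed sequence of sides -/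

/-- **The `t′ = 0` odd-moment `D₄`-orbit certificate along a prescribed sequence** (sequence version of
`fluxStiffness_le_of_torusLimit_oddMoment_orbit_certificate`). Let `−1 ≤ δ ≤ 1`, `λ ∈ ℝ`, `S ⊆ D₄` nonempty, `Ls → ∞`, and let `ρ_s`
(scale `θ₀ > 0`) satisfy `ρ_s θ² ≤ E_{Ls j}(θ) − E_{Ls j}(0)` (`|θ| ≤ θ₀`, `E_L = fluxEnergy L U δ`) at EVERY side of the sequence. If
`|S|⁻¹ Σ_{γ∈S} Re ω_{γΛ₇}(Γ(d4Emb γ 0 Λ₇) X_λ) ≤ q` for every torus limit `ω` of unit sector ground states of `hubbardTorus 2 L 1 U`, then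
`ρ_s ≤ q`. [cite: Lipparini2008, eq. (8.30)] -/
theorem fluxStiffness_le_of_torusLimit_oddMoment_orbit_certificate_seq {U δ ρs θ₀ q : ℝ} (lam : ℝ)
    (S : Finset (DihedralGroup 4)) (hS : S.Nonempty) (hδ : -1 ≤ δ) (hδ1 : δ ≤ 1) (hθ₀ : 0 < θ₀)
    {Ls : ℕ → ℕ} (hLs : Tendsto Ls atTop atTop)
    (hst : ∀ (j : ℕ) [NeZero (Ls j)] (θ : ℝ), |θ| ≤ θ₀ →
      ρs * θ ^ 2 ≤ fluxEnergy (Ls j) U δ θ - fluxEnergy (Ls j) U δ 0)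
    (hrow : ∀ (ω : InfVolFermionState 2) (Ms : ℕ → ℕ) (ψ : ∀ L, Fock (Orb (FermionTorus 2 L))),
      Tendsto Ms atTop atTop →
      (∀ j, IsGroundStateInSector (hubbardTorus 2 (Ms j) 1 U) (rectN (1 - δ) (Ms j)) 0 (ψ (Ms j))) →
      (∀ j, star (ψ (Ms j)) ⬝ᵥ ψ (Ms j) = 1) → ω.IsTorusLimitOf ψ Ms →
        (S.card : ℝ)⁻¹ * ∑ γ ∈ S, rotOddMomentLimitFunctional U lam γ ω ≤ q) :
    ρs ≤ q := by
  have hcard : (0 : ℝ) < (S.card : ℝ) := Nat.cast_pos.2 (Finset.card_pos.2 hS)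
  refine fluxStiffness_le_of_torusLimitTT'_functional_row_seq 0 (U := U) hδ hδ1 hLs
    (fun L ψ => (S.card : ℝ)⁻¹ * ∑ γ ∈ S, rotOddMomentFunctional U δ lam γ L ψ)
    (fun ω => (S.card : ℝ)⁻¹ * ∑ γ ∈ S, rotOddMomentLimitFunctional U lam γ ω) ?_ ?_ ?_
  · filter_upwards [hLs.eventually_ge_atTop 3] with j hj ψ hgs h1
    haveI : NeZero (Ls j) := ⟨by omega⟩
    have hgs' : IsGroundStateInSector (hubbardTorus 2 (Ls j) 1 U) (rectN (1 - δ) (Ls j)) 0 ψ := by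
      simpa only [hubbardTorusTT'_zero] using hgs
    have hsum : ∑ _γ ∈ S, ρs ≤ ∑ γ ∈ S, rotOddMomentFunctional U δ lam γ (Ls j) ψ :=
      Finset.sum_le_sum fun γ _ =>
        fluxStiffness_le_rotOddMomentFunctional (Ls j) hj hθ₀ (hst j) hgs' h1 lam γ
    rw [Finset.sum_const, nsmul_eq_mul] at hsum
    rw [inv_mul_eq_div, le_div_iff₀ hcard]
    linarith
  · intro ω Ms ψ hMs hgs h1 hω
    refine Tendsto.const_mul _ (tendsto_finsetSum _ fun γ _ => ?_)
    have hlim : Tendsto (fun j => (torusAvgExpect (Ms j) (d4ShiftSet γ 0 (box 2 7))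
        (fermionEmbed (PolySite.d4Emb γ 0 (box 2 7)) (oddMomentObs U lam)) (ψ (Ms j))).re) atTop
        (𝓝 (rotOddMomentLimitFunctional U lam γ ω)) :=
      (Complex.continuous_re.tendsto _).comp (hω _ _)
    refine hlim.congr' ?_
    filter_upwards [hMs.eventually_ge_atTop 15] with j hj
    haveI : NeZero (Ms j) := ⟨by omega⟩
    have hgs' : IsGroundStateInSector (hubbardTorus 2 (Ms j) 1 U) (rectN (1 - δ) (Ms j)) 0 (ψ (Ms j)) := by
      simpa only [hubbardTorusTT'_zero] using hgs j
    exact (rotOddMomentFunctional_eq_torusAvgExpect (Ms j) U δ lam γ hj hgs').symm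
  · intro ω Ms ψ hMs hgs h1 hω
    exact hrow ω Ms ψ hMs (fun j => by simpa only [hubbardTorusTT'_zero] using hgs j) h1 hω

/-- **Registry shape along a prescribed sequence, `t′ = 0`: a LOWER orbit row on the NEGATED word is a stiffness CEILING.**
`SquareTTPrimeCorrOrbitLowerRow 0 U (1−δ) u r S Λ₇ (−X_λ)` (`S` nonempty) with the certified cap `e₀(U, 1−δ, 0) ≤ u` gives `ρ_s ≤ −r` for every
`ρ_s` (scale `θ₀ > 0`) satisfying the flux inequality at every side of a sequence `Ls → ∞` (sequence version of
`fluxStiffness_le_of_oddMoment_orbitLowerRow_neg`). [cite: ScalapinoWhiteZhang1993, §II] -/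
theorem fluxStiffness_le_of_oddMoment_orbitLowerRow_neg_seq {U δ ρs θ₀ : ℝ} (lam : ℝ) {u r : ℚ}
    (S : Finset (DihedralGroup 4)) (hS : S.Nonempty) (hδ : -1 ≤ δ) (hδ1 : δ ≤ 1) (hθ₀ : 0 < θ₀)
    {Ls : ℕ → ℕ} (hLs : Tendsto Ls atTop atTop)
    (hst : ∀ (j : ℕ) [NeZero (Ls j)] (θ : ℝ), |θ| ≤ θ₀ →
      ρs * θ ^ 2 ≤ fluxEnergy (Ls j) U δ θ - fluxEnergy (Ls j) U δ 0)
    (hrow : SquareTTPrimeCorrOrbitLowerRow 0 U (1 - δ) u r S (box 2 7) (-oddMomentObs U lam))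
    (hu : energyDensityTT' 1 0 U (1 - δ) ≤ ((u : ℚ) : ℝ)) :
    ρs ≤ -((r : ℚ) : ℝ) := by
  refine fluxStiffness_le_of_torusLimit_oddMoment_orbit_certificate_seq lam S hS hδ hδ1 hθ₀ hLs hst
    fun ω Ms ψ hMs hgs h1 hω => ?_
  have h := hrow ω Ms ψ hMs (fun j => by simpa only [hubbardTorusTT'_zero] using hgs j) h1 hω hu
  have hneg : ∀ γ : DihedralGroup 4,
      (ω.expect (d4ShiftSet γ 0 (box 2 7)) (fermionEmbed (PolySite.d4Emb γ 0 (box 2 7)) (-oddMomentObs U lam))).re =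
        -rotOddMomentLimitFunctional U lam γ ω := fun γ => by
    rw [rotOddMomentLimitFunctional, map_neg, map_neg, Complex.neg_re]
  simp only [hneg, Finset.sum_neg_distrib, mul_neg] at h
  linarith

/-! ### §2 The sequence-robust leaf from a certified `t′ = 0` odd-moment row -/

/-- **Leaf discharger (sequence-robust form) from a certified `t′ = 0` odd-moment orbit row at `(U, n, 0)`.** If
`SquareTTPrimeCorrOrbitLowerRow 0 U n u r S (box 2 7) (−oddMomentObs U λ)` holds (`S ⊆ D₄` nonempty, `0 ≤ n ≤ 2`) and the cap `e₀(U, n, 0) ≤ u` is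
certified, then `ObsStiffnessSeqCeilingAt 0 U n c` for every `c ≥ −r`. [cite: ScalapinoWhiteZhang1993, §II] -/
theorem ObsStiffnessSeqCeilingAt_tp0_of_oddMoment_orbitLowerRow (U n lam : ℝ) {u r : ℚ}
    (S : Finset (DihedralGroup 4)) (hS : S.Nonempty) (hn0 : 0 ≤ n) (hn2 : n ≤ 2)
    (hrow : SquareTTPrimeCorrOrbitLowerRow 0 U n u r S (box 2 7) (-oddMomentObs U lam))
    (hu : energyDensityTT' 1 0 U n ≤ ((u : ℚ) : ℝ)) (c : ℚ) (hc : -r ≤ c) :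
    ObsStiffnessSeqCeilingAt 0 U n c := by
  intro ρs θ₀ _ hθ₀ Ls hLs hst
  have hrow' : SquareTTPrimeCorrOrbitLowerRow 0 U (1 - (1 - n)) u r S (box 2 7) (-oddMomentObs U lam) := by
    rw [sub_sub_cancel]; exact hrow
  have hu' : energyDensityTT' 1 0 U (1 - (1 - n)) ≤ ((u : ℚ) : ℝ) := by rw [sub_sub_cancel]; exact hu
  have hst' : ∀ (j : ℕ) [NeZero (Ls j)] (θ : ℝ), |θ| ≤ θ₀ →
      ρs * θ ^ 2 ≤ fluxEnergy (Ls j) U (1 - n) θ - fluxEnergy (Ls j) U (1 - n) 0 := by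
    intro j _ θ hθ
    have h := hst j θ hθ
    rwa [fluxEnergyTT'_tPrime_zero, fluxEnergyTT'_tPrime_zero] at h
  exact (fluxStiffness_le_of_oddMoment_orbitLowerRow_neg_seq lam S hS (by linarith) (by linarith) hθ₀ hLs hst'
    hrow' hu').trans (by exact_mod_cast hc)

/-- **The K3 node's SEQUENCE-ROBUST leaf at A0′**: `ObsStiffnessSeqCeilingAt 0 8 (7/8) (221298191282315853017777403227662399/2¹¹⁹)`
(≈ `0.3329726`), CONDITIONAL ONLY ON THE CLAIM NODES (the `stiffK3` edge, floor #473, cap #354 BY NAME). [cite: ScalapinoWhiteZhang1993, §II] -/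
theorem obs0b_stiffK3_lamm3o256_EXT5Lp_M3U8tp0_c354f473_up_stiffnessSeqLeafAt_of
    (hk : cert_obs0b_stiffK3_lamm3o256_EXT5Lp_M3U8tp0_c354f473_up)
    (hfloor : cert_r473_bs_M3U8tp0_w3_b4_R2_ob5p2_kry1_kry2c3rel_hanK7B4D4_KN4_PR20d4_hanK8c2s_hanK8B4D4_uprime)
    (hcap : cert_dbt299pair_allk) :
    ObsStiffnessSeqCeilingAt 0 8 (7 / 8) (221298191282315853017777403227662399 / 664613997892457936451903530140172288) :=
  ObsStiffnessSeqCeilingAt_tp0_of_oddMoment_orbitLowerRow 8 (7 / 8) ((-3 / 256 : ℝ)) Finset.univ Finset.univ_nonempty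
    (by norm_num) (by norm_num) (hk (m3_tp0_lower_r473_of hfloor)) (m3_tp0_upper_dbt299pair_allk_of hcap) _ (by norm_num)

/-! ### §3 The B1′-K3 decimal in the shape of the cell's other rows -/

/-- **B1′ (odd-moment `stiffK3` edge, registry row 41) from the claim nodes — exact shape of `kt_tp0_kinlo_EXT5Lp_le_decimal` at `U = 8`.**
Nodes `cert_obs0b_stiffK3_lamm3o256_EXT5Lp_M3U8tp0_c354f473_up` ∧ #473 ∧ #354 give the robust leaf `ObsStiffnessSeqCeilingAt 0 8 (7/8) c`, `c ≈ 0.3329726`;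
with the KT dictionary at `(8, 7/8, 0)`: `Tc ≤ 0.2615160` (`Real.pi_lt_d20`). CONDITIONAL on the three nodes and the dictionary.
[cite: HazraVermaRanderia2019, eqs. (2)–(3)] -/
theorem kt_tp0_stiffK3_EXT5Lp_le_decimal_seq (hk : cert_obs0b_stiffK3_lamm3o256_EXT5Lp_M3U8tp0_c354f473_up)
    (hfloor : cert_r473_bs_M3U8tp0_w3_b4_R2_ob5p2_kry1_kry2c3rel_hanK7B4D4_KN4_PR20d4_hanK8c2s_hanK8B4D4_uprime)
    (hcap : cert_dbt299pair_allk) {ρe : ℝ → ℝ} {Tc : ℝ} (h : KTDictionaryAt 0 8 (7 / 8) ρe Tc) : Tc ≤ 0.2615160 := by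
  have hb := h.le_pi_div_four_mul (obs0b_stiffK3_lamm3o256_EXT5Lp_M3U8tp0_c354f473_up_stiffnessSeqLeafAt_of hk hfloor hcap)
  have hπ : π < 3.14159265358979323847 := Real.pi_lt_d20
  have hc : (((221298191282315853017777403227662399 / 664613997892457936451903530140172288 : ℚ) : ℚ) : ℝ) =
      221298191282315853017777403227662399 / 664613997892457936451903530140172288 := by
    push_cast; ring
  rw [hc] at hb
  nlinarith [hb, hπ]

end Summit.Ventures.CertifiedManyBodySolver.Observables

end
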